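import Literature.LinearAlgebra.Matrix.SymplecticSimilitudeCharpoly
import Literature.LinearAlgebra.Matrix.SymplecticAntiInvolutionConjugacy
import Literature.Algebra.Polynomial.QPalindromicRealCounterpart
import HarnessLib

/-!
# `q`-inversive elements of `GSp_{2n}`: block relations and the characteristic polynomial
# `p_γ(x) = det(x²·1 − 2A·x + q·1) = xⁿ h(x + q/x)`, `h = p_{2A}` (Goresky–Tai 2017, §4.1 and Lemma 12)

Topic `Literature/LinearAlgebra/Matrix`; THEOREMS ONLY (no definition, no instance, no named fact; D-0026 net
debt 0).  Lane `lit-hodgefound` (summit `HodgeConjecture`, Track 2 foundations library), seat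
`lit-hodgefound-p15`, generation 56, row g56-#3; sequel of `SymplecticSimilitudeCharpoly` (g55-#6: the block
relations of `GSp_{2n}`, `qγ⁻¹ = (ᵗD −ᵗB; −ᵗC ᵗA)`, Lemma 37), `SymplecticAntiInvolutionConjugacy` (`τ₀`) and
`Literature.Algebra.Polynomial.QPalindromicRealCounterpart` (g56-#1: the real counterpart transform
`𝒯_{q,n}(h) = Σ_{j ≤ n} b_j X^{n−j}(X²+q)^j = xⁿh(x + q/x)`).

THE PRINT.  M. Goresky, Y.-S. Tai, *Real structures on ordinary Abelian varieties*, arXiv:1701.07742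
[GoreskyTai2017RealStructuresOrdinary], §4.1 (held `paper:arxiv-1701.07742`, p0011), verbatim:

> §4.1 Let `R` be an integral domain and let `𝔅₀` be the standard (strongly non-degenerate) symplectic form on
> `R^{2n}` corresponding to the matrix `J = (0 I; −I 0)`. Define the standard involution `τ₀ : R^{2n} → R^{2n}` by
> `τ₀ = (−I 0; 0 I)`. … Let us say that an element `γ ∈ GSp_{2n}(R)` is *`q`-inversive* if it is semisimple,
> has multiplier `q` and if `τ₀ γ τ₀⁻¹ = q γ⁻¹`, or equivalently if `γ = (A B; C ᵗA) ∈ GSp_{2n}(R)` and `B, C`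
> are symmetric, and `A² − BC = qI`. It follows that `BᵗA = AB` and `CA = ᵗAC`.
> **Lemma 12.** Let `γ = (A B; C ᵗA) ∈ GSp_{2n}(ℚ)` be `q`-inversive. Then the following statements are
> equivalent. (1) The matrices `A`, `B`, and `C` are nonsingular. (2) The element `γ` has no eigenvalues in the
> set `{±√q, ±√−q}`. If these properties hold then the matrix `A` is semisimple, and the characteristic
> polynomial of `A` is `h(2x)`, where `h(x)` is the real counterpart (see §16.2) to `p(x)`, the characteristic
> polynomial of `γ`. … *Proof.* One checks that if `w = (u; v)` is an eigenvector of `γ` with eigenvalue `λ`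
> then (a) `τ₀(w) = (−u; v)` is an eigenvector of `γ` with eigenvalue `q/λ` (b) `u` is an eigenvector of `A` with
> eigenvalue `½(λ + q/λ)` …

WHAT IS HERE (Mathlib's `J = Matrix.J m R = (0 −1; 1 0)` is the negative of the printed `J`, which changes none
of the displayed relations; `n = #m`; `τ₀ = fromBlocks (−1) 0 0 1`; «multiplier `q`» is `γᵀJγ = q·J`):
* §1 THE BLOCK RELATIONS, over any commutative ring. For `γ = (A B; C ᵗA)` with `B, C` symmetric:
  **`relations_iff`** — `γᵀJγ = qJ` iff (`CA = ᵗAC` ∧ `AB = BᵗA` ∧ `A² − BC = q·1`) («It follows that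
  `BᵗA = AB` and `CA = ᵗAC`»; the multiplier relation `ᵗAD − ᵗCB = q` IS `A² − BC = q` transposed); the
  `τ₀`-conjugate `τ₀γτ₀ = (A −B; −C ᵗA)` (`tau0_mul_fromBlocks_mul_tau0`); the INVERSE-FREE form of
  «`τ₀γτ₀⁻¹ = qγ⁻¹`»: `γ·(τ₀γτ₀) = q·1` and `(τ₀γτ₀)·γ = q·1` (`mul_tau0Conj_eq_smul_one`,
  `tau0Conj_mul_eq_smul_one`), and for a unit multiplier the printed form `τ₀γτ₀⁻¹ = qγ⁻¹`
  (`tau0_conj_eq_smul_inv`, via the tree's `inv_eq_smul_fromBlocks`), with the converse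
  `transpose_eq_and_symm_of_tau0_conj_eq` («or equivalently»: for `γ ∈ GSp_{2n}` of unit multiplier,
  `τ₀γτ₀⁻¹ = qγ⁻¹` forces `D = ᵗA`, `B = ᵗB`, `C = ᵗC`).
* §2 THE CHARACTERISTIC MATRIX, over any commutative ring: `(x − γ)(x − τ₀γτ₀) = diag(P(x), ᵗP(x))` with
  `P(x) = (x − A)² − BC = x²·1 − x·2A + q·1` (**`charmatrix_mul_charmatrix_tau0Conj`**, `charmatrix_sq_sub_eq`),
  hence `p_γ(x)² = (det P(x))²` (`charpoly_tau0Conj`, **`charpoly_sq_eq_det_sq`**).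
* §3 For ANY square matrix `M` and `q`: `det(x²·1 − x·M + q·1) = 𝒯_{q,n}(p_M) = xⁿ p_M(x + q/x)`
  (**`det_X_sq_smul_one_sub_X_smul_add_eq_transform_charpoly`**, by the Laurent substitution `x ↦ T`, with
  `det(u·1 − M) = p_M(u)` in `R[T;T⁻¹]`), so `det P(x) = 𝒯_{q,n}(p_{2A})` is monic of degree `2n`.
* §4 Over an INTEGRAL DOMAIN: **`charpoly_eq_transform_charpoly_two_smul`** — `p_γ = 𝒯_{q,n}(p_{2A})`, i.e.
  `p_γ(x) = xⁿ h(x + q/x)` with `h = p_{2A}` the characteristic polynomial of `2A = A + A` (written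
  `(A + A).charpoly`; the precise form of the printed
  «the characteristic polynomial of `A` is `h(2x)`», which holds up to the factor `2ⁿ`; no semisimplicity or
  non-singularity hypothesis is needed for this identity), `charpoly_eq_det` (`p_γ = det P`); consequences:
  `p_γ` is `q`-palindromic for EVERY `q`-inversive `γ`, unit or not, semisimple or not (`charpoly_pal` — Lemma 37
  for `q`-inversive elements without Jordan decomposition; the tree's `SymplecticSimilitude.
  charpoly_coeff_eq_pow_mul_charpoly_coeff` needs `q` regular), and over a field the eigenvalue relation of the
  printed proof (b): `λ` is an eigenvalue of `γ` iff `λ ≠ 0` and `λ + q/λ` is an eigenvalue of `2A`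
  (**`isRoot_charpoly_iff`**, `q ≠ 0`), with `λ ↦ q/λ` preserving the eigenvalues (`isRoot_charpoly_div`, (a)).

NOT here: the equivalence (1) ⟺ (2) of Lemma 12 and semisimplicity of `A`; Proposition 13; the converse
construction `γ = (A, (A²−qI)C⁻¹; C, ᵗA)` (sequel row).

## References
* [GoreskyTai2017RealStructuresOrdinary] M. Goresky, Y.-S. Tai, Real structures on ordinary Abelian varieties,
  arXiv:1701.07742 (2017), §4.1 and Lemma 12 with proof (p0011); App. §16.2 (the real counterpart), Lemma 37.
-/

open Matrix Polynomial Finset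
open scoped LaurentPolynomial
open Literature.Algebra.Polynomial

namespace Literature.LinearAlgebra.Matrix.QInversiveCharpoly

variable {R : Type*} [CommRing R] {m : Type*} [Fintype m] [DecidableEq m]

/-! ## §1 Block relations of a `q`-inversive element -/

/-- **The block relations.** For `γ = (A B; C ᵗA)` with `B, C` symmetric: `γ` has multiplier `q` (`ᵗγJγ = qJ`)
iff `CA = ᵗAC`, `AB = BᵗA` and `A² − BC = q·1` («`γ = (A B; C ᵗA) ∈ GSp_{2n}(R)` and `B, C` are symmetric,
and `A² − BC = qI`. It follows that `BᵗA = AB` and `CA = ᵗAC`»).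
[cite: GoreskyTai2017RealStructuresOrdinary, §4.1 (definition of q-inversive, «It follows that BᵗA = AB and CA = ᵗAC») (p0011)] -/
theorem relations_iff {A B C : Matrix m m R} (hB : Bᵀ = B) (hC : Cᵀ = C) (q : R) :
    (fromBlocks A B C Aᵀ)ᵀ * J m R * fromBlocks A B C Aᵀ = q • J m R ↔
      C * A = Aᵀ * C ∧ A * B = B * Aᵀ ∧ A * A - B * C = q • (1 : Matrix m m R) := by
  rw [SymplecticSimilitude.fromBlocks_transpose_mul_J_mul_eq_smul_J_iff, hB, hC, transpose_transpose]
  constructor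
  · rintro ⟨h1, h2, h3⟩
    refine ⟨h1.symm, h2.symm, ?_⟩
    have := congrArg transpose h3
    rwa [transpose_sub, transpose_mul, transpose_mul, transpose_transpose, hB, hC, transpose_smul,
      transpose_one] at this
  · rintro ⟨h1, h2, h3⟩
    refine ⟨h1.symm, h2.symm, ?_⟩
    have := congrArg transpose h3
    rwa [transpose_sub, transpose_mul, transpose_mul, hB, hC, transpose_smul, transpose_one] at this

/-- `τ₀γτ₀ = (A −B; −C D)` for `τ₀ = (−1 0; 0 1)`. [cite: GoreskyTai2017RealStructuresOrdinary, §4.1 «τ₀ = (−I 0; 0 I)» ∕ proof of Lemma 12 (a) «τ₀(w) = (−u; v)» (p0011)] -/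
theorem tau0_mul_fromBlocks_mul_tau0 (A B C D : Matrix m m R) :
    fromBlocks (-1 : Matrix m m R) 0 0 1 * fromBlocks A B C D * fromBlocks (-1 : Matrix m m R) 0 0 1 =
      fromBlocks A (-B) (-C) D := by
  rw [fromBlocks_multiply, fromBlocks_multiply]
  simp

/-- **«`τ₀γτ₀⁻¹ = qγ⁻¹`», inverse-free**: for `γ = (A B; C ᵗA)` with `B, C` symmetric, `AB = BᵗA`,
`CA = ᵗAC`, `A² − BC = q·1` one has `γ · (τ₀γτ₀) = q·1`.
[cite: GoreskyTai2017RealStructuresOrdinary, §4.1 «τ₀ γ τ₀⁻¹ = q γ⁻¹, or equivalently … A² − BC = qI» (p0011)] -/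
theorem mul_tau0Conj_eq_smul_one {A B C : Matrix m m R} {q : R} (hB : Bᵀ = B) (hC : Cᵀ = C)
    (hAB : A * B = B * Aᵀ) (hCA : C * A = Aᵀ * C) (hq : A * A - B * C = q • (1 : Matrix m m R)) :
    fromBlocks A B C Aᵀ * fromBlocks A (-B) (-C) Aᵀ = q • (1 : Matrix (m ⊕ m) (m ⊕ m) R) := by
  have hD : Aᵀ * Aᵀ - C * B = q • (1 : Matrix m m R) := by
    have := congrArg transpose hq
    rwa [transpose_sub, transpose_mul, transpose_mul, hB, hC, transpose_smul, transpose_one] at this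
  rw [fromBlocks_multiply, ← fromBlocks_one, fromBlocks_smul]
  congr 1
  · rw [Matrix.mul_neg, ← sub_eq_add_neg, hq]
  · rw [Matrix.mul_neg, hAB, smul_zero, neg_add_cancel]
  · rw [Matrix.mul_neg, hCA, smul_zero, add_neg_cancel]
  · rw [Matrix.mul_neg, neg_add_eq_sub, hD]

/-- … and `(τ₀γτ₀) · γ = q·1`. [cite: GoreskyTai2017RealStructuresOrdinary, §4.1 «τ₀ γ τ₀⁻¹ = q γ⁻¹» (p0011)] -/
theorem tau0Conj_mul_eq_smul_one {A B C : Matrix m m R} {q : R} (hB : Bᵀ = B) (hC : Cᵀ = C)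
    (hAB : A * B = B * Aᵀ) (hCA : C * A = Aᵀ * C) (hq : A * A - B * C = q • (1 : Matrix m m R)) :
    fromBlocks A (-B) (-C) Aᵀ * fromBlocks A B C Aᵀ = q • (1 : Matrix (m ⊕ m) (m ⊕ m) R) := by
  have hD : Aᵀ * Aᵀ - C * B = q • (1 : Matrix m m R) := by
    have := congrArg transpose hq
    rwa [transpose_sub, transpose_mul, transpose_mul, hB, hC, transpose_smul, transpose_one] at this
  rw [fromBlocks_multiply, ← fromBlocks_one, fromBlocks_smul]
  congr 1
  · rw [Matrix.neg_mul, ← sub_eq_add_neg, hq]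
  · rw [Matrix.neg_mul, hAB, smul_zero, add_neg_cancel]
  · rw [Matrix.neg_mul, hCA, smul_zero, neg_add_cancel]
  · rw [Matrix.neg_mul, neg_add_eq_sub, hD]

/-- **«`τ₀γτ₀⁻¹ = qγ⁻¹`» as printed**, for a unit multiplier `q`: `γ = (A B; C ᵗA) ∈ GSp_{2n}(R)` with `B, C`
symmetric satisfies `τ₀γτ₀ = q·γ⁻¹` (note `τ₀⁻¹ = τ₀`). [cite: GoreskyTai2017RealStructuresOrdinary, §4.1 «τ₀ γ τ₀⁻¹ = q γ⁻¹» (p0011)] -/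
theorem tau0_conj_eq_smul_inv {A B C : Matrix m m R} (hB : Bᵀ = B) (hC : Cᵀ = C) (u : Rˣ)
    (h : (fromBlocks A B C Aᵀ)ᵀ * J m R * fromBlocks A B C Aᵀ = (u : R) • J m R) :
    fromBlocks (-1 : Matrix m m R) 0 0 1 * fromBlocks A B C Aᵀ * fromBlocks (-1 : Matrix m m R) 0 0 1 =
      (u : R) • (fromBlocks A B C Aᵀ)⁻¹ := by
  rw [tau0_mul_fromBlocks_mul_tau0, SymplecticSimilitude.inv_eq_smul_fromBlocks u h, smul_smul,
    Units.mul_inv, one_smul, transpose_transpose, hB, hC]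

/-- **«or equivalently»**: conversely, if `γ = (A B; C D) ∈ GSp_{2n}(R)` has unit multiplier `q` and
`τ₀γτ₀ = qγ⁻¹`, then `D = ᵗA` and `B`, `C` are symmetric. [cite: GoreskyTai2017RealStructuresOrdinary, §4.1 «τ₀ γ τ₀⁻¹ = q γ⁻¹, or equivalently if γ = (A B; C ᵗA) ∈ GSp_{2n}(R) and B, C are symmetric» (p0011)] -/
theorem transpose_eq_and_symm_of_tau0_conj_eq {A B C D : Matrix m m R} (u : Rˣ)
    (h : (fromBlocks A B C D)ᵀ * J m R * fromBlocks A B C D = (u : R) • J m R)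
    (hτ : fromBlocks (-1 : Matrix m m R) 0 0 1 * fromBlocks A B C D * fromBlocks (-1 : Matrix m m R) 0 0 1 =
      (u : R) • (fromBlocks A B C D)⁻¹) :
    D = Aᵀ ∧ Bᵀ = B ∧ Cᵀ = C := by
  rw [tau0_mul_fromBlocks_mul_tau0, SymplecticSimilitude.inv_eq_smul_fromBlocks u h, smul_smul,
    Units.mul_inv, one_smul] at hτ
  obtain ⟨-, hB', hC', hD⟩ := fromBlocks_inj.mp hτ
  exact ⟨hD, (neg_inj.mp hB').symm, (neg_inj.mp hC').symm⟩

/-! ## §2 The characteristic matrix: `(x − γ)(x − τ₀γτ₀) = diag(P, ᵗP)` -/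

/-- The characteristic matrix of `τ₀γτ₀ = (A −B; −C ᵗA)`. [cite: GoreskyTai2017RealStructuresOrdinary, §4.1 (p0011)] -/
theorem charmatrix_tau0Conj (A B C : Matrix m m R) :
    charmatrix (fromBlocks A (-B) (-C) Aᵀ) =
      fromBlocks (charmatrix A) (B.map Polynomial.C) (C.map Polynomial.C) (charmatrix A)ᵀ := by
  rw [charmatrix_fromBlocks, charmatrix_transpose]
  congr 1 <;> ext i j <;> simp

/-- `(x·1 − A)² − BC = x²·1 − x·(2A) + q·1` (as polynomial matrices) when `A² − BC = q·1`.
[cite: GoreskyTai2017RealStructuresOrdinary, §4.1 «A² − BC = qI» ∕ proof of Lemma 12 (b) «½(λ + q/λ)» (p0011)] -/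
theorem charmatrix_sq_sub_eq {A B C : Matrix m m R} {q : R} (hq : A * A - B * C = q • (1 : Matrix m m R)) :
    charmatrix A * charmatrix A - B.map Polynomial.C * C.map Polynomial.C =
      ((X : R[X]) ^ 2 + Polynomial.C q) • (1 : Matrix m m R[X]) - (X : R[X]) • (A + A).map Polynomial.C := by
  set A' := A.map (Polynomial.C : R →+* R[X]) with hA'
  set B' := B.map (Polynomial.C : R →+* R[X]) with hB'
  set C' := C.map (Polynomial.C : R →+* R[X]) with hC'
  have hone : (q • (1 : Matrix m m R)).map (Polynomial.C : R →+* R[X]) =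
      Polynomial.C q • (1 : Matrix m m R[X]) := by
    ext i j
    by_cases h : i = j <;> simp [h]
  have hmap : A' * A' - B' * C' = Polynomial.C q • (1 : Matrix m m R[X]) := by
    have := congrArg (Polynomial.C : R →+* R[X]).mapMatrix hq
    simp only [map_sub, map_mul, RingHom.mapMatrix_apply] at this
    rw [this, hone]
  have h2 : (A + A).map (Polynomial.C : R →+* R[X]) = A' + A' := by
    ext i j; simp [hA']
  have hcA : charmatrix A = (X : R[X]) • (1 : Matrix m m R[X]) - A' := by
    rw [Matrix.charmatrix, RingHom.mapMatrix_apply, scalar_apply, ← smul_one_eq_diagonal]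
  rw [hcA, h2]
  have key : ((X : R[X]) • (1 : Matrix m m R[X]) - A') * ((X : R[X]) • (1 : Matrix m m R[X]) - A') =
      ((X : R[X]) ^ 2) • (1 : Matrix m m R[X]) - (X : R[X]) • (A' + A') + A' * A' := by
    simp only [sub_mul, mul_sub, Matrix.smul_mul, Matrix.mul_smul, Matrix.one_mul, Matrix.mul_one,
      smul_smul, smul_add, sq]
    abel
  rw [key, add_smul, show ((X : R[X]) ^ 2) • (1 : Matrix m m R[X]) - (X : R[X]) • (A' + A') + A' * A' -
      B' * C' = ((X : R[X]) ^ 2) • (1 : Matrix m m R[X]) - (X : R[X]) • (A' + A') + (A' * A' - B' * C') by abel,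
    hmap]
  abel

/-- **`(x − γ)(x − τ₀γτ₀) = diag(P(x), ᵗP(x))`** with `P(x) = (x − A)² − BC`, for `γ = (A B; C ᵗA)`, `B, C`
symmetric, `AB = BᵗA`, `CA = ᵗAC`. [cite: GoreskyTai2017RealStructuresOrdinary, §4.1 (the q-inversive relations) ∕ proof of Lemma 12 (a)–(c) (p0011)] -/
theorem charmatrix_mul_charmatrix_tau0Conj {A B C : Matrix m m R} (hB : Bᵀ = B) (hC : Cᵀ = C)
    (hAB : A * B = B * Aᵀ) (hCA : C * A = Aᵀ * C) :
    charmatrix (fromBlocks A B C Aᵀ) * charmatrix (fromBlocks A (-B) (-C) Aᵀ) =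
      fromBlocks (charmatrix A * charmatrix A - B.map Polynomial.C * C.map Polynomial.C) 0 0
        (charmatrix A * charmatrix A - B.map Polynomial.C * C.map Polynomial.C)ᵀ := by
  set A' := A.map (Polynomial.C : R →+* R[X]) with hA'
  set B' := B.map (Polynomial.C : R →+* R[X]) with hB'
  set C' := C.map (Polynomial.C : R →+* R[X]) with hC'
  have hB't : B'ᵀ = B' := by rw [hB', ← Matrix.transpose_map, hB]
  have hC't : C'ᵀ = C' := by rw [hC', ← Matrix.transpose_map, hC]
  have hAB' : A' * B' = B' * A'ᵀ := by
    have := congrArg (Polynomial.C : R →+* R[X]).mapMatrix hAB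
    simpa only [map_mul, RingHom.mapMatrix_apply, Matrix.transpose_map] using this
  have hCA' : C' * A' = A'ᵀ * C' := by
    have := congrArg (Polynomial.C : R →+* R[X]).mapMatrix hCA
    simpa only [map_mul, RingHom.mapMatrix_apply, Matrix.transpose_map] using this
  have hcA : charmatrix A = scalar m (X : R[X]) - A' := rfl
  have hsc : ∀ M : Matrix m m R[X], scalar m (X : R[X]) * M = M * scalar m (X : R[X]) :=
    fun M => (scalar_commute (X : R[X]) (fun r => Commute.all _ _) M).eq
  rw [charmatrix_fromBlocks, charmatrix_tau0Conj, charmatrix_transpose, fromBlocks_multiply]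
  congr 1
  · rw [Matrix.neg_mul, sub_eq_add_neg]
  · -- `cA·B' − B'·cAᵀ = 0`
    rw [Matrix.neg_mul, hcA, transpose_sub, scalar_apply, diagonal_transpose, ← scalar_apply, sub_mul,
      mul_sub, hsc B', hAB']
    abel
  · -- `−C'·cA + cAᵀ·C' = 0`
    rw [Matrix.neg_mul, hcA, transpose_sub, scalar_apply, diagonal_transpose, ← scalar_apply, sub_mul,
      mul_sub, hsc C', hCA']
    abel
  · -- `cAᵀ² − C'B' = ᵗ(cA² − B'C')`
    rw [Matrix.neg_mul, transpose_sub, transpose_mul, transpose_mul, hB't, hC't]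
    abel

/-- `τ₀γτ₀` has the same characteristic polynomial as `γ`. [cite: GoreskyTai2017RealStructuresOrdinary, proof of Lemma 12 (a) «τ₀(w) is an eigenvector of γ with eigenvalue q/λ» (p0011)] -/
theorem charpoly_tau0Conj (A B C D : Matrix m m R) :
    (fromBlocks A (-B) (-C) D).charpoly = (fromBlocks A B C D).charpoly := by
  rw [← tau0_mul_fromBlocks_mul_tau0, charpoly_mul_comm, ← Matrix.mul_assoc,
    SymplecticAntiInvolution.tau0_mul_tau0, Matrix.one_mul]

/-- **`p_γ(x)² = (det P(x))²`** with `P(x) = (x − A)² − BC`, over any commutative ring.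
[cite: GoreskyTai2017RealStructuresOrdinary, §4.1 ∕ Lemma 12 (p0011)] -/
theorem charpoly_sq_eq_det_sq {A B C : Matrix m m R} (hB : Bᵀ = B) (hC : Cᵀ = C) (hAB : A * B = B * Aᵀ)
    (hCA : C * A = Aᵀ * C) :
    (fromBlocks A B C Aᵀ).charpoly ^ 2 =
      (charmatrix A * charmatrix A - B.map Polynomial.C * C.map Polynomial.C).det ^ 2 := by
  rw [sq, sq]
  nth_rewrite 2 [← charpoly_tau0Conj A B C Aᵀ]
  rw [Matrix.charpoly, Matrix.charpoly, ← det_mul, charmatrix_mul_charmatrix_tau0Conj hB hC hAB hCA,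
    det_fromBlocks_zero₂₁, det_transpose]

/-! ## §3 `det(x²·1 − x·M + q·1) = xⁿ p_M(x + q/x)` for every square matrix `M` -/

/-- In `R[T;T⁻¹]`: `det(u·1 − M) = p_M(u)` for `u = T + qT⁻¹` (indeed for any `u`).
[cite: GoreskyTai2017RealStructuresOrdinary, proof of Lemma 12 (b) (eigenvalues ½(λ + q/λ) of A) (p0011)] -/
theorem det_scalar_sub_map_eq_aeval_charpoly (M : Matrix m m R) (u : R[T;T⁻¹]) :
    (scalar m u - M.map LaurentPolynomial.C).det = aeval u M.charpoly := by
  have halg : algebraMap R R[T;T⁻¹] = LaurentPolynomial.C :=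
    RingHom.ext fun r => (LaurentPolynomial.C_eq_algebraMap r).symm
  rw [aeval_def, halg, ← eval_map, ← charpoly_map, eval_charpoly]

/-- **`det(x²·1 − x·M + q·1) = 𝒯_{q,n}(p_M) = xⁿ p_M(x + q/x)`** for every `M ∈ M_n(R)` and `q ∈ R`, over any
commutative ring (the substitution `y = x + q/x`, `xⁿ·det(y − M)`, made polynomial by the Laurent ring).
[cite: GoreskyTai2017RealStructuresOrdinary, Lemma 12 «the characteristic polynomial of A is h(2x), where h(x) is the real counterpart to p(x)» and its proof (b) (p0011); App. §16.2 «p(x) = xⁿh(x + q/x)» (p0036)] -/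
theorem det_X_sq_smul_one_sub_X_smul_add_eq_transform_charpoly (M : Matrix m m R) (q : R) :
    (((X : R[X]) ^ 2 + Polynomial.C q) • (1 : Matrix m m R[X]) - (X : R[X]) • M.map Polynomial.C).det =
      ∑ j ∈ Finset.range (Fintype.card m + 1), Polynomial.C (M.charpoly.coeff j) *
        X ^ (Fintype.card m - j) * (X ^ 2 + Polynomial.C q) ^ j := by
  apply toLaurent_injective
  have hdeg : M.charpoly.natDegree ≤ Fintype.card m := by
    rcases subsingleton_or_nontrivial R with hR | hR
    · simp [natDegree_of_subsingleton]
    · exact (charpoly_natDegree_eq_dim M).le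
  rw [QPalindromicRealCounterpart.toLaurent_transform q _ _ hdeg, ← det_scalar_sub_map_eq_aeval_charpoly,
    RingHom.map_det, RingHom.mapMatrix_apply]
  -- the mapped matrix is `T · (u·1 − M)` with `u = T + qT⁻¹`
  have hmat : (((X : R[X]) ^ 2 + Polynomial.C q) • (1 : Matrix m m R[X]) -
      (X : R[X]) • M.map Polynomial.C).map (toLaurent (R := R)) =
      (LaurentPolynomial.T 1 : R[T;T⁻¹]) • (scalar m (LaurentPolynomial.T 1 + LaurentPolynomial.C q *
        LaurentPolynomial.T (-1)) - M.map LaurentPolynomial.C) := by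
    have e0 : (LaurentPolynomial.T 1 * LaurentPolynomial.T (-1) : R[T;T⁻¹]) = 1 := by
      rw [← LaurentPolynomial.T_add]; norm_num
    refine Matrix.ext fun i j => ?_
    rw [scalar_apply]
    simp only [Matrix.map_apply, Matrix.sub_apply, Matrix.smul_apply, smul_eq_mul, Matrix.one_apply,
      diagonal_apply]
    split_ifs with h
    · simp only [mul_one, map_sub, map_mul, map_add, map_pow, toLaurent_X, toLaurent_C]
      linear_combination (-(LaurentPolynomial.C q)) * e0
    · simp only [mul_zero, zero_sub, map_neg, map_mul, toLaurent_X, toLaurent_C]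
      ring
  rw [hmat, det_smul, LaurentPolynomial.T_pow, mul_one]

/-- `det P(x) = det((x − A)² − BC) = 𝒯_{q,n}(p_{2A})` when `A² − BC = q·1`.
[cite: GoreskyTai2017RealStructuresOrdinary, Lemma 12 «the characteristic polynomial of A is h(2x)» (p0011)] -/
theorem det_charmatrix_sq_sub_eq_transform {A B C : Matrix m m R} {q : R}
    (hq : A * A - B * C = q • (1 : Matrix m m R)) :
    (charmatrix A * charmatrix A - B.map Polynomial.C * C.map Polynomial.C).det =
      ∑ j ∈ Finset.range (Fintype.card m + 1), Polynomial.C ((A + A).charpoly.coeff j) *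
        X ^ (Fintype.card m - j) * (X ^ 2 + Polynomial.C q) ^ j := by
  rw [charmatrix_sq_sub_eq hq, det_X_sq_smul_one_sub_X_smul_add_eq_transform_charpoly]

/-- `det P(x)` is monic of degree `2n`. [cite: GoreskyTai2017RealStructuresOrdinary, Lemma 12 (p0011); App. §16.2 (p0036)] -/
theorem monic_det_charmatrix_sq_sub [Nontrivial R] {A B C : Matrix m m R} {q : R}
    (hq : A * A - B * C = q • (1 : Matrix m m R)) :
    (charmatrix A * charmatrix A - B.map Polynomial.C * C.map Polynomial.C).det.Monic ∧
      (charmatrix A * charmatrix A - B.map Polynomial.C * C.map Polynomial.C).det.natDegree =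
        2 * Fintype.card m := by
  rw [det_charmatrix_sq_sub_eq_transform hq]
  exact QPalindromicRealCounterpart.monic_transform q _ (charpoly_monic _) (charpoly_natDegree_eq_dim _)

/-! ## §4 Over an integral domain: `p_γ = det P = xⁿ p_{2A}(x + q/x)` -/

/-- Cancellation of squares of monic polynomials over a domain. [folklore] -/
private theorem eq_of_sq_eq_sq_of_monic [IsDomain R] {f g : R[X]} (hf : f.Monic) (hg : g.Monic)
    (h : f ^ 2 = g ^ 2) : f = g := by
  have h0 : (f - g) * (f + g) = 0 := by linear_combination h
  rcases mul_eq_zero.mp h0 with h1 | h1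
  · exact sub_eq_zero.mp h1
  · -- `f = −g` with both monic forces `2 = 0`, and then `−g = g`
    have hfg : f = -g := eq_neg_of_add_eq_zero_left h1
    have h2 : (2 : R) = 0 := by
      have := congrArg leadingCoeff hfg
      rw [leadingCoeff_neg, hf.leadingCoeff, hg.leadingCoeff] at this
      linear_combination this
    rw [hfg]
    ext k
    rw [coeff_neg]
    have : (2 : R) * g.coeff k = 0 := by rw [h2, zero_mul]
    linear_combination -this

/-- **`p_γ(x) = det((x − A)² − BC)`** for a `q`-inversive `γ = (A B; C ᵗA)` over an integral domain.
[cite: GoreskyTai2017RealStructuresOrdinary, §4.1 ∕ Lemma 12 (p0011)] -/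
theorem charpoly_eq_det [IsDomain R] {A B C : Matrix m m R} {q : R} (hB : Bᵀ = B) (hC : Cᵀ = C)
    (hAB : A * B = B * Aᵀ) (hCA : C * A = Aᵀ * C) (hq : A * A - B * C = q • (1 : Matrix m m R)) :
    (fromBlocks A B C Aᵀ).charpoly =
      (charmatrix A * charmatrix A - B.map Polynomial.C * C.map Polynomial.C).det :=
  eq_of_sq_eq_sq_of_monic (charpoly_monic _) (monic_det_charmatrix_sq_sub hq).1
    (charpoly_sq_eq_det_sq hB hC hAB hCA)

/-- **The characteristic polynomial of a `q`-inversive element: `p_γ = 𝒯_{q,n}(p_{2A})`, i.e.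
`p_γ(x) = xⁿ h(x + q/x)` with `h` the characteristic polynomial of `2A`** (over an integral domain; no
semisimplicity or non-singularity hypothesis). This is the precise content of the printed «the characteristic
polynomial of `A` is `h(2x)`, where `h(x)` is the real counterpart to `p(x)`» (which holds up to the factor `2ⁿ`).
[cite: GoreskyTai2017RealStructuresOrdinary, Lemma 12 and proof (b) (p0011); App. §16.2 (p0036)] -/
theorem charpoly_eq_transform_charpoly_two_smul [IsDomain R] {A B C : Matrix m m R} {q : R} (hB : Bᵀ = B)
    (hC : Cᵀ = C) (hAB : A * B = B * Aᵀ) (hCA : C * A = Aᵀ * C)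
    (hq : A * A - B * C = q • (1 : Matrix m m R)) :
    (fromBlocks A B C Aᵀ).charpoly =
      ∑ j ∈ Finset.range (Fintype.card m + 1), Polynomial.C ((A + A).charpoly.coeff j) *
        X ^ (Fintype.card m - j) * (X ^ 2 + Polynomial.C q) ^ j := by
  rw [charpoly_eq_det hB hC hAB hCA hq, det_charmatrix_sq_sub_eq_transform hq]

/-- The same from the `GSp` hypothesis: `γ = (A B; C ᵗA)` of multiplier `q` with `B, C` symmetric.
[cite: GoreskyTai2017RealStructuresOrdinary, §4.1 and Lemma 12 (p0011)] -/
theorem charpoly_eq_transform_charpoly_two_smul' [IsDomain R] {A B C : Matrix m m R} {q : R} (hB : Bᵀ = B)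
    (hC : Cᵀ = C) (h : (fromBlocks A B C Aᵀ)ᵀ * J m R * fromBlocks A B C Aᵀ = q • J m R) :
    (fromBlocks A B C Aᵀ).charpoly =
      ∑ j ∈ Finset.range (Fintype.card m + 1), Polynomial.C ((A + A).charpoly.coeff j) *
        X ^ (Fintype.card m - j) * (X ^ 2 + Polynomial.C q) ^ j := by
  obtain ⟨hCA, hAB, hq⟩ := (relations_iff hB hC q).mp h
  exact charpoly_eq_transform_charpoly_two_smul hB hC hAB hCA hq

/-- **Lemma 37 for `q`-inversive elements** (any `q`, any integral domain, no semisimplicity): the characteristic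
polynomial of `γ = (A B; C ᵗA)` is `q`-palindromic, `a_{n−r} = q^r a_{n+r}`.
[cite: GoreskyTai2017RealStructuresOrdinary, App. §16.2 Lemma 37 (p0037); §4.1 (p0011)] -/
theorem charpoly_pal [IsDomain R] {A B C : Matrix m m R} {q : R} (hB : Bᵀ = B) (hC : Cᵀ = C)
    (hAB : A * B = B * Aᵀ) (hCA : C * A = Aᵀ * C) (hq : A * A - B * C = q • (1 : Matrix m m R)) {r : ℕ}
    (hr : r ≤ Fintype.card m) :
    (fromBlocks A B C Aᵀ).charpoly.coeff (Fintype.card m - r) =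
      q ^ r * (fromBlocks A B C Aᵀ).charpoly.coeff (Fintype.card m + r) := by
  rw [charpoly_eq_transform_charpoly_two_smul hB hC hAB hCA hq]
  exact QPalindromicRealCounterpart.transform_pal q _ _ hr

section Field

variable {K : Type*} [Field K] {m : Type*} [Fintype m] [DecidableEq m]

/-- **The eigenvalue relation (proof of Lemma 12, (b))**: for a `q`-inversive `γ = (A B; C ᵗA)` over a field
with `q ≠ 0`, `λ` is an eigenvalue of `γ` (a root of `p_γ`) iff `λ ≠ 0` and `λ + q/λ` is an eigenvalue of `2A`
(«`u` is an eigenvector of `A` with eigenvalue `½(λ + q/λ)`»).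
[cite: GoreskyTai2017RealStructuresOrdinary, proof of Lemma 12 (b) (p0011)] -/
theorem isRoot_charpoly_iff {A B C : Matrix m m K} {q : K} (hq0 : q ≠ 0) (hB : Bᵀ = B) (hC : Cᵀ = C)
    (hAB : A * B = B * Aᵀ) (hCA : C * A = Aᵀ * C) (hq : A * A - B * C = q • (1 : Matrix m m K)) (x : K) :
    (fromBlocks A B C Aᵀ).charpoly.IsRoot x ↔ x ≠ 0 ∧ (A + A).charpoly.IsRoot (x + q / x) := by
  rw [charpoly_eq_transform_charpoly_two_smul hB hC hAB hCA hq]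
  exact QPalindromicRealCounterpart.isRoot_transform_iff hq0 _ (charpoly_monic _)
    (charpoly_natDegree_eq_dim _) x

/-- **(a) `λ ↦ q/λ` preserves the eigenvalues of a `q`-inversive `γ`** («`τ₀(w)` is an eigenvector of `γ` with
eigenvalue `q/λ`»). [cite: GoreskyTai2017RealStructuresOrdinary, proof of Lemma 12 (a) (p0011)] -/
theorem isRoot_charpoly_div {A B C : Matrix m m K} {q : K} (hq0 : q ≠ 0) (hB : Bᵀ = B) (hC : Cᵀ = C)
    (hAB : A * B = B * Aᵀ) (hCA : C * A = Aᵀ * C) (hq : A * A - B * C = q • (1 : Matrix m m K)) {x : K}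
    (hx : (fromBlocks A B C Aᵀ).charpoly.IsRoot x) : (fromBlocks A B C Aᵀ).charpoly.IsRoot (q / x) := by
  rw [charpoly_eq_transform_charpoly_two_smul hB hC hAB hCA hq] at hx ⊢
  exact QPalindromicRealCounterpart.isRoot_transform_div hq0 _ (charpoly_monic _)
    (charpoly_natDegree_eq_dim _) hx

end Field

end Literature.LinearAlgebra.Matrix.QInversiveCharpoly
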